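import Summits.QuantumFields.YangMills.Theorems.BalabanLadderInfVolNontrivial
import Summits.QuantumFields.YangMills.Theorems.BalabanLadderInfVolFloorsCore
import Summits.QuantumFields.YangMills.Theorems.InfiniteVolumeLatticeDistributions
import Literature.MathematicalPhysics.QuantumLattice.SchwartzTranslationCutoff
import Summits.QuantumFields.YangMills.Theorems.RecentredCoverTransferMeanShiftNecessary
import HarnessLib

/-!
# Slot shifts of tensor tests and the BASE ← CENTRE junction under a smeared bound (toolkit for B7K)

Planner seat `ym-idea-11` g17; landing kit file **K3 of 4** (= HOME `g17/rev4/mc_b7k.lean` §1–§2, sha8 e07de6df).  Route-independent analysis: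

* §1 `isOffDiagonal_of_separated`, `isOffDiagonal_shift_of_isTensorOf`: slot supports with pairwise disjoint `δ`-thickenings ⇒ every slot shift of size
  `< δ` (`SchwartzMap.compSubConstCLM`) keeps the tensor in `⁰𝒮`; the separations for the compact floor witnesses `exists_sep_two` (θv | v),
  `exists_sep_three` (`Disjoint.exists_thickenings`); slot offsets `ctrOff` (`‖a·o_q‖ ≤ a`), strong continuity `tendsto_compSubConst_ctrOff`;
* §2 `tendsto_base_of_centre`: for probability states `μ_k`, spacings `a_k → 0⁺` and a test `F ∈ ⁰𝒮` whose small slot shifts stay in `⁰𝒮`, the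
  smeared bound `‖Σ' M(μ_k)·G(centres)‖ ≤ c‖G‖_m` transports convergence of the CENTRE series to the BASE series (difference = centre series of
  `F_k − F`, `≤ c‖F_k − F‖_m → 0`).

References: K. Osterwalder, R. Schrader, CMP 31 (1973) §2 (`⁰𝒮`); L. Hörmander, ALPDO I §7.1 (translations act strongly continuously on `𝒮`).
HONEST LABEL: soft analysis / calibration / bookkeeping on HYPOTHESES; nothing here proves NT, a β-uniform bound, the leaf 19868
unconditionally, any crux, rung or summit; nothing about Bałaban's RG or Clay is asserted; the Yang–Mills mass gap is NOT proved.
-/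

set_option autoImplicit false

noncomputable section

open scoped BigOperators SchwartzMap
open MeasureTheory Filter Topology
open Literature.MathematicalPhysics.QuantumFieldTheory hiding ZdEdge
open Literature.MathematicalPhysics.QuantumLattice
open Literature.MathematicalPhysics.AQFT
open Literature.Probability.LatticeModels (Site)
open Summit.QuantumFields.YangMills.Cruxes.OSLegsFromFemtoAndGap.DlrCollarTransfer (plane exists_abs_plane_le)
open Summit.QuantumFields.YangMills.Theorems.HypercubicLimit.Negative (tsupport_thetaTest_neg)
open Summit.QuantumFields.YangMills.Theorems.RecentredCoverTransfer (tsupport_ofRealTest)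
open Summit.QuantumFields.YangMills.Theorems.InfiniteVolume (stateMomentStr abs_stateMomentStr_le summable_mul_of_bounded)

namespace Summit.QuantumFields.YangMills.Cruxes.AtomicCalibrationR.MirrorCalibration

/-! ## §1 Slot shifts of tensor tests with separated supports stay off-diagonal -/

section Toolkit

variable {n : ℕ}

/-- **Separated slot supports ⇒ off-diagonal.**  If `T` vanishes unless every `z i − c i ∈ K i`, the `K i` are closed with
pairwise disjoint `δ`-thickenings and `‖c i‖ < δ`, then `T ∈ ⁰𝒮`. [folklore] -/
theorem isOffDiagonal_of_separated (T : 𝓢((Fin n → EuclideanSpace ℝ (Fin 4)), ℂ))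
    (K : Fin n → Set (EuclideanSpace ℝ (Fin 4))) (hK : ∀ i, IsClosed (K i)) (c : Fin n → EuclideanSpace ℝ (Fin 4))
    {δ : ℝ} (hc : ∀ i, ‖c i‖ < δ)
    (hdisj : ∀ i j, i ≠ j → Disjoint (Metric.thickening δ (K i)) (Metric.thickening δ (K j)))
    (hsupp : Function.support (T : (Fin n → EuclideanSpace ℝ (Fin 4)) → ℂ) ⊆
      {z | ∀ i, z i - c i ∈ K i}) : IsOffDiagonal T := by
  apply IsOffDiagonal.of_tsupport_subset
  have hSc : IsClosed {z : Fin n → EuclideanSpace ℝ (Fin 4) | ∀ i, z i - c i ∈ K i} := by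
    have hEq : {z : Fin n → EuclideanSpace ℝ (Fin 4) | ∀ i, z i - c i ∈ K i} =
        ⋂ i, (fun z : Fin n → EuclideanSpace ℝ (Fin 4) => z i - c i) ⁻¹' K i := by
      ext z; simp
    rw [hEq]
    exact isClosed_iInter fun i => (hK i).preimage ((continuous_apply i).sub continuous_const)
  refine (closure_minimal hsupp hSc).trans ?_
  rintro z hz ⟨i, j, hij, hzij⟩
  have hmem : ∀ l, z l ∈ Metric.thickening δ (K l) := fun l =>
    Metric.mem_thickening_iff.2 ⟨z l - c l, hz l, by rw [dist_eq_norm, sub_sub_cancel]; exact hc l⟩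
  refine Set.disjoint_left.1 (hdisj i j hij) (hmem i) ?_
  rw [hzij]
  exact hmem j

/-- The support of a slot-shifted tensor `z ↦ T(z − c)` lies in `{z | ∀ i, z i − c i ∈ tsupport fᵢ}`. [folklore] -/
theorem support_compSubConst_subset {T : 𝓢((Fin n → EuclideanSpace ℝ (Fin 4)), ℂ)}
    {fs : Fin n → 𝓢(EuclideanSpace ℝ (Fin 4), ℂ)} (hT : IsTensorOf T fs) (c : Fin n → EuclideanSpace ℝ (Fin 4)) :
    Function.support ((SchwartzMap.compSubConstCLM ℂ c T : 𝓢((Fin n → EuclideanSpace ℝ (Fin 4)), ℂ)) :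
        (Fin n → EuclideanSpace ℝ (Fin 4)) → ℂ) ⊆
      {z | ∀ i, z i - c i ∈ tsupport (fs i : EuclideanSpace ℝ (Fin 4) → ℂ)} := by
  intro z hz i
  rw [Function.mem_support, SchwartzMap.compSubConstCLM_apply, hT] at hz
  have hi := Finset.prod_ne_zero_iff.1 hz i (Finset.mem_univ i)
  exact subset_tsupport _ (Function.mem_support.2 hi)

/-- **Slot shifts smaller than the separation keep a tensor off-diagonal.** [folklore] -/
theorem isOffDiagonal_shift_of_isTensorOf {T : 𝓢((Fin n → EuclideanSpace ℝ (Fin 4)), ℂ)}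
    {fs : Fin n → 𝓢(EuclideanSpace ℝ (Fin 4), ℂ)} (hT : IsTensorOf T fs) {δ : ℝ}
    (hsep : ∀ i j, i ≠ j → Disjoint (Metric.thickening δ (tsupport (fs i : EuclideanSpace ℝ (Fin 4) → ℂ)))
      (Metric.thickening δ (tsupport (fs j : EuclideanSpace ℝ (Fin 4) → ℂ))))
    (c : Fin n → EuclideanSpace ℝ (Fin 4)) (hc : ∀ i, ‖c i‖ < δ) :
    IsOffDiagonal (SchwartzMap.compSubConstCLM ℂ c T) :=
  isOffDiagonal_of_separated _ (fun i => tsupport (fs i : EuclideanSpace ℝ (Fin 4) → ℂ))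
    (fun _ => isClosed_tsupport _) c hc hsep (support_compSubConst_subset hT c)

/-- **Separation for the two-point witness**: `v` compactly supported in positive times ⇒ the supports of `θv` and `v`
have disjoint `δ`-thickenings. [folklore] -/
theorem exists_sep_two {v : 𝓢(EuclideanSpace ℝ (Fin 4), ℝ)} (hvc : HasCompactSupport (v : EuclideanSpace ℝ (Fin 4) → ℝ))
    (hv : tsupport (v : EuclideanSpace ℝ (Fin 4) → ℝ) ⊆ {y : EuclideanSpace ℝ (Fin 4) | 0 < y 0}) :
    ∃ δ : ℝ, 0 < δ ∧ ∀ i j : Fin (1 + 1), i ≠ j →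
      Disjoint
        (Metric.thickening δ (tsupport ((fun i => ofRealTest (![thetaTest 4 v, v] i)) i :
          EuclideanSpace ℝ (Fin 4) → ℂ)))
        (Metric.thickening δ (tsupport ((fun i => ofRealTest (![thetaTest 4 v, v] i)) j :
          EuclideanSpace ℝ (Fin 4) → ℂ))) := by
  have hdj : Disjoint (tsupport (v : EuclideanSpace ℝ (Fin 4) → ℝ))
      (tsupport (thetaTest 4 v : EuclideanSpace ℝ (Fin 4) → ℝ)) :=
    Set.disjoint_left.2 fun y hy hy' => by
      have h1 : 0 < y 0 := hv hy
      have h2 : y 0 < 0 := tsupport_thetaTest_neg hv hy'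
      linarith
  obtain ⟨δ, hδ, hsep⟩ := hdj.exists_thickenings hvc (isClosed_tsupport _)
  refine ⟨δ, hδ, fun i j hij => ?_⟩
  fin_cases i <;> fin_cases j
  · exact absurd rfl hij
  · simpa [tsupport_ofRealTest] using hsep.symm
  · simpa [tsupport_ofRealTest] using hsep
  · exact absurd rfl hij

/-- **Separation for the three-point witnesses**: compact pairwise disjoint supports have pairwise disjoint
`δ`-thickenings for one common `δ > 0`. [folklore] -/
theorem exists_sep_three {f g h : 𝓢(EuclideanSpace ℝ (Fin 4), ℝ)}
    (hfc : HasCompactSupport (f : EuclideanSpace ℝ (Fin 4) → ℝ)) (hgc : HasCompactSupport (g : EuclideanSpace ℝ (Fin 4) → ℝ))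
    (hfg : Disjoint (tsupport f) (tsupport g)) (hgh : Disjoint (tsupport g) (tsupport h))
    (hfh : Disjoint (tsupport f) (tsupport h)) :
    ∃ δ : ℝ, 0 < δ ∧ ∀ i j : Fin 3, i ≠ j →
      Disjoint
        (Metric.thickening δ (tsupport ((![ofRealTest f, ofRealTest g, ofRealTest h] :
          Fin 3 → 𝓢(EuclideanSpace ℝ (Fin 4), ℂ)) i : EuclideanSpace ℝ (Fin 4) → ℂ)))
        (Metric.thickening δ (tsupport ((![ofRealTest f, ofRealTest g, ofRealTest h] :
          Fin 3 → 𝓢(EuclideanSpace ℝ (Fin 4), ℂ)) j : EuclideanSpace ℝ (Fin 4) → ℂ))) := by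
  obtain ⟨δ₁, hδ₁, h₁⟩ := hfg.exists_thickenings hfc (isClosed_tsupport _)
  obtain ⟨δ₂, hδ₂, h₂⟩ := hgh.exists_thickenings hgc (isClosed_tsupport _)
  obtain ⟨δ₃, hδ₃, h₃⟩ := hfh.exists_thickenings hfc (isClosed_tsupport _)
  refine ⟨min δ₁ (min δ₂ δ₃), lt_min hδ₁ (lt_min hδ₂ hδ₃), fun i j hij => ?_⟩
  have m1 : min δ₁ (min δ₂ δ₃) ≤ δ₁ := min_le_left _ _
  have m2 : min δ₁ (min δ₂ δ₃) ≤ δ₂ := (min_le_right _ _).trans (min_le_left _ _)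
  have m3 : min δ₁ (min δ₂ δ₃) ≤ δ₃ := (min_le_right _ _).trans (min_le_right _ _)
  have h₁' := h₁.mono (Metric.thickening_mono m1 _) (Metric.thickening_mono m1 _)
  have h₂' := h₂.mono (Metric.thickening_mono m2 _) (Metric.thickening_mono m2 _)
  have h₃' := h₃.mono (Metric.thickening_mono m3 _) (Metric.thickening_mono m3 _)
  fin_cases i <;> fin_cases j
  · exact absurd rfl hij
  · simpa [tsupport_ofRealTest] using h₁'
  · simpa [tsupport_ofRealTest] using h₃'
  · simpa [tsupport_ofRealTest] using h₁'.symm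
  · exact absurd rfl hij
  · simpa [tsupport_ofRealTest] using h₂'
  · simpa [tsupport_ofRealTest] using h₃'.symm
  · simpa [tsupport_ofRealTest] using h₂'.symm
  · exact absurd rfl hij

/-- The plaquette-centre direction vectors `e_{q_l.1} + e_{q_l.2}`. -/
def ctrDir (q : Fin n → Fin 4 × Fin 4) : Fin n → EuclideanSpace ℝ (Fin 4) :=
  fun l => EuclideanSpace.single (q l).1 (1 : ℝ) + EuclideanSpace.single (q l).2 (1 : ℝ)

/-- The slot offsets `a·o_q` of the plaquette centres at spacing `s`: `(s/2)(e_{q_l.1} + e_{q_l.2})`. -/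
def ctrOff (s : ℝ) (q : Fin n → Fin 4 × Fin 4) : Fin n → EuclideanSpace ℝ (Fin 4) :=
  (s / 2) • ctrDir q

/-- Unfolding of the slot offset `ctrOff s q l = (s/2)(e_{q_l.1} + e_{q_l.2})`. -/
theorem ctrOff_apply (s : ℝ) (q : Fin n → Fin 4 × Fin 4) (l : Fin n) :
    ctrOff s q l = (s / 2) • (EuclideanSpace.single (q l).1 (1 : ℝ) + EuclideanSpace.single (q l).2 (1 : ℝ)) := rfl

/-- `‖a·o_q‖ ≤ a`. [folklore] -/
theorem norm_ctrOff_le {s : ℝ} (hs : 0 ≤ s) (q : Fin n → Fin 4 × Fin 4) (l : Fin n) : ‖ctrOff s q l‖ ≤ s := by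
  rw [ctrOff_apply, norm_smul, Real.norm_eq_abs, abs_of_nonneg (by linarith)]
  have h1 : ‖EuclideanSpace.single (q l).1 (1 : ℝ) + EuclideanSpace.single (q l).2 (1 : ℝ)‖ ≤ 2 :=
    (norm_add_le _ _).trans (by norm_num)
  nlinarith

/-- The base point is the centre point of the slot-shifted test: `F(a·x) = F_k(a·x + a·o_q)` with
`F_k := F(· − a·o_q)`. [folklore] -/
theorem compSubConst_ctrOff_apply_centre (s : ℝ) (q : Fin n → Fin 4 × Fin 4)
    (F : 𝓢((Fin n → EuclideanSpace ℝ (Fin 4)), ℂ)) (x : Fin n → Site 4) :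
    SchwartzMap.compSubConstCLM ℂ (ctrOff s q) F
        (fun l => s • siteToE (x l) +
          (s / 2) • (EuclideanSpace.single (q l).1 (1 : ℝ) + EuclideanSpace.single (q l).2 (1 : ℝ))) =
      F (fun l => s • siteToE (x l)) := by
  rw [SchwartzMap.compSubConstCLM_apply]
  congr 1
  funext l
  simp [ctrOff_apply]

/-- **Strong continuity of slot shifts**: `F(· − a_k·o_q) → F` in `𝒮` as `a_k → 0`. [folklore] -/
theorem tendsto_compSubConst_ctrOff {s : ℕ → ℝ} (hs0 : Tendsto s atTop (𝓝 0)) (q : Fin n → Fin 4 × Fin 4)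
    (F : 𝓢((Fin n → EuclideanSpace ℝ (Fin 4)), ℂ)) :
    Tendsto (fun k => SchwartzMap.compSubConstCLM ℂ (ctrOff (s k) q) F) atTop (𝓝 F) := by
  have h0 : Tendsto (fun k => ctrOff (s k) q) atTop (𝓝 0) := by
    simpa [ctrOff] using (hs0.div_const 2).smul_const (ctrDir q)
  have h1 : Tendsto (fun k => SchwartzMap.compSubConstCLM ℂ (ctrOff (s k) q) F) atTop
      (𝓝 (SchwartzMap.compSubConstCLM ℂ (0 : Fin n → EuclideanSpace ℝ (Fin 4)) F)) :=
    ((continuous_compSubConstCLM (𝕜 := ℂ) F).tendsto 0).comp h0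
  simpa using h1

/-- `‖F_k − F‖_m → 0` when `F_k → F` in `𝒮`. [folklore] -/
theorem tendsto_schwartzNorm_sub {m : ℕ} {Fk : ℕ → 𝓢((Fin n → EuclideanSpace ℝ (Fin 4)), ℂ)}
    {F : 𝓢((Fin n → EuclideanSpace ℝ (Fin 4)), ℂ)} (h : Tendsto Fk atTop (𝓝 F)) :
    Tendsto (fun k => schwartzNorm m (Fk k - F)) atTop (𝓝 0) := by
  have hqc : Continuous fun G : 𝓢((Fin n → EuclideanSpace ℝ (Fin 4)), ℂ) => schwartzNorm m G :=
    Seminorm.continuous_finsetSup (s := Finset.Iic (m, m)) fun i _ =>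
      (schwartz_withSeminorms ℂ (Fin n → EuclideanSpace ℝ (Fin 4)) ℂ).continuous_seminorm i
  have h1 : Tendsto (fun k => Fk k - F) atTop (𝓝 0) := by
    simpa using h.sub (tendsto_const_nhds (x := F))
  have h2 := (hqc.tendsto 0).comp h1
  rwa [show schwartzNorm m (0 : 𝓢((Fin n → EuclideanSpace ℝ (Fin 4)), ℂ)) = 0 from map_zero _] at h2

end Toolkit

/-! ## §2 The junction: base-point series converge to the same limit as the centre series -/

section Junction

variable {G : Type} [Group G] [TopologicalSpace G] [IsTopologicalGroup G] [CompactSpace G]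
  [MeasurableSpace G] {n : ℕ}

/-- **BASE ← CENTRE under a smeared bound.**  Probability states `μ_k`, spacings `s_k → 0⁺`, an orientation tuple `q`,
the smeared bound `‖Σ' M(μ_k)·G(centres)‖ ≤ c‖G‖_m` on `⁰𝒮`, and a test `F ∈ ⁰𝒮` whose centre series converge to `L` and
whose slot shifts `F(· − s_k·o_q)` are eventually in `⁰𝒮`: then the BASE-point series `Σ' M(μ_k)·F(s_k·x)` converge to `L`
too. [folklore] -/
theorem tendsto_base_of_centre (r : LatticeRep G) (μ : ℕ → Measure (LGConfig 4 G))
    [hμ : ∀ k, IsProbabilityMeasure (μ k)] (s : ℕ → ℝ) (hs : ∀ k, 0 < s k) (hs0 : Tendsto s atTop (𝓝 0))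
    (q : Fin n → Fin 4 × Fin 4) {c : ℝ} {m : ℕ}
    (hbd : ∀ (k : ℕ) (F : 𝓢((Fin n → EuclideanSpace ℝ (Fin 4)), ℂ)), IsOffDiagonal F →
      ‖∑' x : Fin n → Site 4, ((stateMomentStr G r (μ k) n q x : ℝ) : ℂ) *
          F (fun l => s k • siteToE (x l) +
            (s k / 2) • (EuclideanSpace.single (q l).1 (1 : ℝ) + EuclideanSpace.single (q l).2 (1 : ℝ)))‖ ≤
        c * schwartzNorm m F)
    (F : 𝓢((Fin n → EuclideanSpace ℝ (Fin 4)), ℂ)) (hF : IsOffDiagonal F) {L : ℂ}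
    (hconv : Tendsto (fun k => ∑' x : Fin n → Site 4, ((stateMomentStr G r (μ k) n q x : ℝ) : ℂ) *
          F (fun l => s k • siteToE (x l) +
            (s k / 2) • (EuclideanSpace.single (q l).1 (1 : ℝ) + EuclideanSpace.single (q l).2 (1 : ℝ))))
        atTop (𝓝 L))
    (hFk : ∀ᶠ k in atTop, IsOffDiagonal (SchwartzMap.compSubConstCLM ℂ (ctrOff (s k) q) F)) :
    Tendsto (fun k => ∑' x : Fin n → Site 4, ((stateMomentStr G r (μ k) n q x : ℝ) : ℂ) *
        F (fun l => s k • siteToE (x l))) atTop (𝓝 L) := by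
  obtain ⟨Cp, hCp⟩ := exists_abs_plane_le (G := G) r
  have hCp0 : 0 ≤ Cp := le_trans (abs_nonneg _) (hCp (0, 1) 0 (fun _ => 1))
  -- centre points and shifted tests
  set ctr : ℕ → (Fin n → Site 4) → (Fin n → EuclideanSpace ℝ (Fin 4)) := fun k x l =>
    s k • siteToE (x l) +
      (s k / 2) • (EuclideanSpace.single (q l).1 (1 : ℝ) + EuclideanSpace.single (q l).2 (1 : ℝ)) with hctr
  set Fk : ℕ → 𝓢((Fin n → EuclideanSpace ℝ (Fin 4)), ℂ) :=
    fun k => SchwartzMap.compSubConstCLM ℂ (ctrOff (s k) q) F with hFk_def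
  -- (1) base series = centre series of the shifted test
  have hbase : ∀ k (x : Fin n → Site 4), F (fun l => s k • siteToE (x l)) = Fk k (ctr k x) := fun k x =>
    (compSubConst_ctrOff_apply_centre (s k) q F x).symm
  -- (2) summability of centre series for small spacings
  have hsmall : ∀ᶠ k in atTop, s k ≤ 1 / 24 := hs0.eventually (eventually_le_nhds (by norm_num))
  have hWsup : ∀ k (x : Fin n → Site 4), |stateMomentStr G r (μ k) n q x| ≤ (Cp + Cp) ^ n := fun k x =>
    abs_stateMomentStr_le r (μ k) hCp q x
  have hyx : ∀ k (x : Fin n → Site 4) (l : Fin n), ‖ctr k x l - s k • siteToE (x l)‖ ≤ 6 * s k := by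
    intro k x l
    have h1 : ctr k x l - s k • siteToE (x l) = ctrOff (s k) q l := by
      simp only [hctr, ctrOff_apply]; abel
    rw [h1]
    linarith [norm_ctrOff_le (s := s k) (hs k).le q l, (hs k).le]
  have hsum : ∀ k, s k ≤ 1 / 24 → ∀ G' : 𝓢((Fin n → EuclideanSpace ℝ (Fin 4)), ℂ),
      Summable fun x : Fin n → Site 4 => ((stateMomentStr G r (μ k) n q x : ℝ) : ℂ) * G' (ctr k x) := by
    intro k hk G'
    exact summable_mul_of_bounded (hs k) (by linarith) (by linarith : 6 * s k ≤ 1 / 4) (pow_nonneg (by positivity) n)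
      (fun x => stateMomentStr G r (μ k) n q x) (hWsup k) G' (ctr k) (hyx k)
  -- (3) the difference is controlled by the smeared bound
  have hdiff_bd : ∀ᶠ k in atTop,
      ‖(∑' x : Fin n → Site 4, ((stateMomentStr G r (μ k) n q x : ℝ) : ℂ) * F (fun l => s k • siteToE (x l))) -
          ∑' x : Fin n → Site 4, ((stateMomentStr G r (μ k) n q x : ℝ) : ℂ) * F (ctr k x)‖ ≤
        c * schwartzNorm m (Fk k - F) := by
    filter_upwards [hsmall, hFk] with k hk hFk'
    have hsplit : (∑' x : Fin n → Site 4, ((stateMomentStr G r (μ k) n q x : ℝ) : ℂ) *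
          F (fun l => s k • siteToE (x l))) =
        (∑' x : Fin n → Site 4, ((stateMomentStr G r (μ k) n q x : ℝ) : ℂ) * F (ctr k x)) +
          ∑' x : Fin n → Site 4, ((stateMomentStr G r (μ k) n q x : ℝ) : ℂ) * (Fk k - F) (ctr k x) := by
      rw [← Summable.tsum_add (hsum k hk F) (hsum k hk (Fk k - F))]
      refine tsum_congr fun x => ?_
      rw [hbase k x, sub_apply]
      ring
    rw [hsplit, add_sub_cancel_left]
    exact hbd k (Fk k - F) (hFk'.sub hF)
  -- (4) `‖F_k − F‖_m → 0`
  have hN : Tendsto (fun k => c * schwartzNorm m (Fk k - F)) atTop (𝓝 0) := by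
    simpa using (tendsto_schwartzNorm_sub (m := m) (tendsto_compSubConst_ctrOff hs0 q F)).const_mul c
  have hdiff : Tendsto (fun k =>
      (∑' x : Fin n → Site 4, ((stateMomentStr G r (μ k) n q x : ℝ) : ℂ) * F (fun l => s k • siteToE (x l))) -
        ∑' x : Fin n → Site 4, ((stateMomentStr G r (μ k) n q x : ℝ) : ℂ) * F (ctr k x)) atTop (𝓝 0) :=
    squeeze_zero_norm' hdiff_bd hN
  have h := hconv.add hdiff
  rw [add_zero] at h
  exact h.congr fun k => by simp only [hctr]; ring

end Junction

end Summit.QuantumFields.YangMills.Cruxes.AtomicCalibrationR.MirrorCalibration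

end
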